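import Literature.Geometry.DiscreteGeometry.TwoShellIntegerModel

/-!
# Overbinding budget — compressed cut: EXACT ADJACENCY KERNELS (layer rigidity, combinatorial core)

Support file for the open leaf `NearFieldSlackMinSecond 12 (1/25)` of
`OverbindingBudgetAffineCompressedCutFirst` (node «CompressedCut», critic rows 1404/1421): the
combinatorial crux is LAYER RIGIDITY `LR(r₁)` — in the deep two-shell-registered regime the sites
around `i` are an exact close-packed (Barlow) stack.  The transport machinery in the tree
(`…CompressedCutDict/Classes/Transfer/Op/Step`) turns every registered bond `j → k` into an EXACT
linear isometry `R₁` of model frames with an exact dictionary (`R₁ w = v − v_k` for every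
dictionary pair, by Gram exactness `dict_gram_record`).  What remains combinatorial is finite and
is settled here by kernel computation (`decide +kernel` over integer triples):

* the two model patterns at the common scale `1/√18` as lists of integer triples, together with
  the four ALIGNED copies `F⁺ = fccModelInt`, `F⁻` (basal mirror), `H = hcpModelInt`, `H′ = −H`
  that occur as site patterns of a Barlow stack with layer normal `(1,1,1)` (§1);
* the pull-back `tpull u w W = d • R₁(W)` (`d = det w = ±54`) of a child pattern point along a
  tetrahedral frame pair `u ↦ w` (integer Cramer numerators, cf. `cramerInt`, `model_cramer`) (§0);
* the Boolean ADJACENCY KERNEL `kernelB P x xrs S Qs` (§2): for a parent pattern `P` (parents at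
  the stack sites `x − xr`, `xr ∈ xrs`), a child at `x` with model `S`, EVERY tetrahedral frame
  `(x; b, c)` and EVERY unit tetrahedral triple `(w₁, w₂, w₃)` of `S` whose pull-back registers the
  points of each listed parent ADJACENT to the child, the pull-back of `S` is one of the copies
  `Qs` — with its soundness theorem `kernelB_sound` (Prop form, §3);
* bridges to `Fin 3 → ℤ` / `fccModelInt` / `hcpModelInt` / `cramerInt` (§4).

The kernel TABLES (fcc growth `KF`, in-layer growth `E1`, two-parent stacking `UP2`) are the
sibling files `…CompressedCutKernelKF/E1/Up`.  Numerics and the full enumeration (identical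
formulation, pure integer arithmetic): cell `decomp-a2c`, `decomp-a2c-lens-4/g80/numerics/kernels.py`.
No `sorry`, no new axioms, no instances.
-/

namespace Summit.AtomisticToContinuum.Crystallization.Theorems.OverbindingBudgetAffineCompressedCutKernel

open Literature.Geometry.DiscreteGeometry (sqNormInt det3Int cramerInt fccModelInt hcpModelInt)

/-! ## §0  Integer triples (kernel-friendly arithmetic) -/

/-- Computation-friendly integer triples; `toV` (§4) converts to `Fin 3 → ℤ`. [this file] -/
abbrev T3 := ℤ × ℤ × ℤ

/-- Difference. [this file] -/
def tsub (a b : T3) : T3 := (a.1 - b.1, a.2.1 - b.2.1, a.2.2 - b.2.2)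
/-- Sum. [this file] -/
def tadd (a b : T3) : T3 := (a.1 + b.1, a.2.1 + b.2.1, a.2.2 + b.2.2)
/-- Negation. [this file] -/
def tneg (a : T3) : T3 := (-a.1, -a.2.1, -a.2.2)
/-- Integer scaling. [this file] -/
def tscale (k : ℤ) (a : T3) : T3 := (k * a.1, k * a.2.1, k * a.2.2)
/-- Squared norm (`= sqNormInt ∘ toV`). [this file] -/
def tsq (a : T3) : ℤ := a.1 * a.1 + a.2.1 * a.2.1 + a.2.2 * a.2.2
/-- Height numerator w.r.t. the layer normal `(1,1,1)`. [this file] -/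
def thsum (a : T3) : ℤ := a.1 + a.2.1 + a.2.2
/-- Boolean equality test. [this file] -/
def teq (a b : T3) : Bool := a.1 == b.1 && a.2.1 == b.2.1 && a.2.2 == b.2.2
/-- Determinant of the matrix with columns `a, b, c` (`= det3Int` on `toV`). [this file] -/
def tdet (a b c : T3) : ℤ :=
  a.1 * (b.2.1 * c.2.2 - b.2.2 * c.2.1) - b.1 * (a.2.1 * c.2.2 - a.2.2 * c.2.1) + c.1 * (a.2.1 * b.2.2 - a.2.2 * b.2.1)
/-- PULL-BACK along a frame pair `uᵢ ↦ wᵢ`: `tpull u w W = Σᵢ (cramer w W)ᵢ • uᵢ = (det w) • R₁ W` for the linear map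
`R₁` with `R₁ wᵢ = uᵢ` (integer Cramer numerators; cf. `cramerInt_spec`, `model_cramer`). [this file] -/
def tpull (u₁ u₂ u₃ w₁ w₂ w₃ W : T3) : T3 :=
  tadd (tadd (tscale (tdet W w₂ w₃) u₁) (tscale (tdet w₁ W w₃) u₂)) (tscale (tdet w₁ w₂ W) u₃)
/-- Boolean implication. [this file] -/
def impB (a b : Bool) : Bool := !a || b

/-- `impB_eq_true` (docstring added by the landing lane; see the module docstring). [formal bookkeeping] -/
theorem impB_eq_true (a b : Bool) : impB a b = true ↔ (a = true → b = true) := by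
  cases a <;> cases b <;> simp [impB]

/-- `teq_eq_true` (docstring added by the landing lane; see the module docstring). [formal bookkeeping] -/
theorem teq_eq_true (a b : T3) : teq a b = true ↔ a = b := by
  obtain ⟨a₁, a₂, a₃⟩ := a
  obtain ⟨b₁, b₂, b₃⟩ := b
  simp [teq, Bool.and_eq_true, beq_iff_eq, and_assoc]

/-! ## §1  The patterns and their aligned copies (layer normal `(1,1,1)`, scale `1/√18`) -/

/-- `fccModelInt` as a list: the aligned fcc copy `F⁺` (caps `(3,3,0)`-type above, `(-3,-3,0)`-type below). [this file] -/
def fccL : List T3 :=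
  [(3, 3, 0), (3, 0, 3), (3, 0, -3), (3, -3, 0), (0, 3, 3), (0, 3, -3),
   (0, -3, 3), (0, -3, -3), (-3, 3, 0), (-3, 0, 3), (-3, 0, -3), (-3, -3, 0),
   (6, 0, 0), (0, 6, 0), (0, 0, 6), (0, 0, -6), (0, -6, 0), (-6, 0, 0)]

/-- `hcpModelInt` as a list: the aligned hcp copy `H` (eclipsed caps `(3,3,0)`-type / `(-1,-1,-4)`-type). [this file] -/
def hcpL : List T3 :=
  [(3, 3, 0), (3, 0, 3), (3, 0, -3), (3, -3, 0), (0, 3, 3), (0, 3, -3),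
   (0, -3, 3), (-1, -1, -4), (-1, -4, -1), (-3, 3, 0), (-3, 0, 3), (-4, -1, -1),
   (6, 0, 0), (2, -4, -4), (0, 6, 0), (0, 0, 6), (-4, 2, -4), (-4, -4, 2)]

/-- The aligned fcc copy `F⁻`: the mirror image of `F⁺` in the basal plane `x + y + z = 0`
(caps `(1,1,4)`-type / `(-1,-1,-4)`-type). [this file] -/
def fccNegL : List T3 :=
  [(4, 1, 1), (3, 0, -3), (3, -3, 0), (1, 4, 1), (1, 1, 4), (0, 3, -3),
   (0, -3, 3), (-1, -1, -4), (-1, -4, -1), (-3, 3, 0), (-3, 0, 3), (-4, -1, -1),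
   (4, 4, -2), (4, -2, 4), (2, -4, -4), (-2, 4, 4), (-4, 2, -4), (-4, -4, 2)]

/-- The aligned hcp copy `H′ = −H` (eclipsed caps `(1,1,4)`-type / `(-3,-3,0)`-type). [this file] -/
def hcpAltL : List T3 :=
  [(4, 1, 1), (3, 0, -3), (3, -3, 0), (1, 4, 1), (1, 1, 4), (0, 3, -3),
   (0, -3, 3), (0, -3, -3), (-3, 3, 0), (-3, 0, 3), (-3, 0, -3), (-3, -3, 0),
   (4, 4, -2), (4, -2, 4), (0, 0, -6), (0, -6, 0), (-2, 4, 4), (-6, 0, 0)]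

/-- The common basal hexagon: the six permutations of `(3,-3,0)`. [this file] -/
def hexL : List T3 :=
  [(3, 0, -3), (3, -3, 0), (0, 3, -3), (0, -3, 3), (-3, 3, 0), (-3, 0, 3)]

/-- The polar (cap) first-shell points of a pattern on the side `s = ±1` of the basal plane. [this file] -/
def capL (P : List T3) (s : ℤ) : List T3 :=
  P.filter fun v => tsq v == 18 && thsum v == 6 * s

/-- Coordinatewise sign flip (a symmetry of `fccModelInt` fixing the frame axes). [this file] -/
def tflip (s a : T3) : T3 := (s.1 * a.1, s.2.1 * a.2.1, s.2.2 * a.2.2)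

/-- The eight hcp copies adjacent to an fcc site along its twelve bonds: `tflip s` of `H` and of `H′` for the four
sign classes `s` (basal normals `(±1,±1,±1)`). [this file] -/
def hcpFamilyL : List (List T3) :=
  [((1 : ℤ), (1 : ℤ), (1 : ℤ)), (1, 1, -1), (1, -1, 1), (-1, 1, 1)].flatMap fun s =>
    [hcpL.map (tflip s), hcpAltL.map (tflip s)]

/-- Sanity (by `decide`): `H′ = −H`, `F⁻` is the basal mirror image of `F⁺`, all four copies consist of `12 + 6`
vectors of squared norms `18 / 36` at heights `−6, 0, 6` and contain the basal hexagon. [this file] -/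
theorem aligned_copies_shape :
    (hcpAltL.all fun p => hcpL.any fun q => teq (tneg p) q) = true ∧
    (fccNegL.all fun p => fccL.any fun q => teq (tsub p (tscale ((2 * thsum p) / 3) (1, 1, 1))) q) = true ∧
    ([fccL, fccNegL, hcpL, hcpAltL].all fun P =>
      P.length == 18 && (P.filter fun v => tsq v == 18).length == 12 && (P.filter fun v => tsq v == 36).length == 6 &&
      (P.all fun v => thsum v == -6 || thsum v == 0 || thsum v == 6) && hexL.all fun h => P.any fun v => teq h v) = true := by
  refine ⟨?_, ?_, ?_⟩ <;> decide +kernel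

/-! ## §2  The Boolean adjacency kernel -/

/-- The first-shell points of `P` adjacent to the first-shell point `x` (its four common neighbours with the centre).
[this file] -/
def nbrL (P : List T3) (x : T3) : List T3 :=
  P.filter fun v => tsq v == 18 && tsq (tsub v x) == 18

/-- A CHOSEN tetrahedral frame `(x; b, c)` at `x`: the first pair of mutually adjacent points of `nbrL P x`
(junk `(x, x)` if none; `tetraOkB` certifies the choice). [this file] -/
def tetraPick (P : List T3) (x : T3) : T3 × T3 :=
  match (nbrL P x).flatMap fun b => ((nbrL P x).filter fun c => tsq (tsub c b) == 18).map fun c => (b, c) with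
  | [] => (x, x)
  | bc :: _ => bc

/-- Certificate that `(x; b, c)` is a unit tetrahedral frame of points of `P`. [this file] -/
def tetraOkB (P : List T3) (x b c : T3) : Bool :=
  P.any (teq b) && P.any (teq c) &&
    (tsq b == 18 && tsq (tsub b x) == 18 && tsq c == 18 && tsq (tsub c x) == 18 && tsq (tsub b c) == 18)

/-- REGISTRATION of one parent: every point of the parent pattern-with-centre `0 :: P` ADJACENT to the child at
`xr` (squared model distance `18`) is, as a vector from the child, a pulled-back child point (`pulled` is the list
`tpull u w W, W ∈ S`; `d = tdet w₁ w₂ w₃`). [this file] -/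
def regB (P pulled : List T3) (d : ℤ) (xr : T3) : Bool :=
  (((0, 0, 0) : T3) :: P).all fun V =>
    impB (tsq (tsub V xr) == 18) (pulled.any fun p => teq p (tscale d (tsub V xr)))

/-- CONCLUSION for one copy: the pulled-back child pattern is contained in `d • Q`. [this file] -/
def conclB (Q pulled : List T3) (d : ℤ) : Bool :=
  let dQ := Q.map (tscale d)
  pulled.all fun p => dQ.any fun q => teq p q

/-- **The adjacency kernel.**  Parent pattern `P` (an aligned copy; parents at the stack sites `x − xr`, `xr ∈ xrs`,
all carrying `P`), child at `x` (a first-shell point of `P`) with model `S`, the chosen tetrahedral frame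
`(x; b, c) = tetraPick P x`; for every unit tetrahedral triple `(w₁, w₂, w₃)` of `S` (the dictionary images of
`−x, b − x, c − x`) whose pull-back registers the adjacent points of every listed parent, the pull-back of `S` lies
in a copy from `Qs`. [this file] -/
def kernelB (P : List T3) (x : T3) (xrs : List T3) (S : List T3) (Qs : List (List T3)) : Bool :=
  let b := (tetraPick P x).1
  let c := (tetraPick P x).2
  tetraOkB P x b c && (
  S.all fun w₁ => impB (tsq w₁ == 18) <|
  S.all fun w₂ => impB (tsq w₂ == 18 && tsq (tsub w₁ w₂) == 18) <|
  S.all fun w₃ => impB (tsq w₃ == 18 && tsq (tsub w₁ w₃) == 18 && tsq (tsub w₂ w₃) == 18) <|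
    let d := tdet w₁ w₂ w₃
    let pulled := S.map (tpull (tneg x) (tsub b x) (tsub c x) w₁ w₂ w₃)
    impB (xrs.all fun xr => regB P pulled d xr) (Qs.any fun Q => conclB Q pulled d))

/-- The kernel over all children in a list `xs` with a single parent (`xrs = [x]`). [this file] -/
def kernelOneB (P xs S : List T3) (Qs : List (List T3)) : Bool :=
  xs.all fun x => kernelB P x [x] S Qs

/-- The kernel over all children `x` in the cap `capL P s` with TWO adjacent parents: at `0` and at `x − x₂` for the
other cap points `x₂` (the child's lower/upper neighbours in the parent layer). [this file] -/
def kernelTwoB (P : List T3) (s : ℤ) (S : List T3) (Qs : List (List T3)) : Bool :=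
  (capL P s).all fun x => (capL P s).all fun x₂ => impB (!(teq x x₂)) (kernelB P x [x, x₂] S Qs)

/-! ## §3  Soundness (Prop forms) -/

/-- Registration hypothesis for the parent whose child-offset is `xr`. [this file] -/
def RegAt (P S : List T3) (xr u₁ u₂ u₃ w₁ w₂ w₃ : T3) : Prop :=
  ∀ V ∈ ((0, 0, 0) : T3) :: P, tsq (tsub V xr) = 18 →
    ∃ W ∈ S, tpull u₁ u₂ u₃ w₁ w₂ w₃ W = tscale (tdet w₁ w₂ w₃) (tsub V xr)

/-- Conclusion: the child model `S` pulls back INTO `d • Q`. [this file] -/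
def PullsInto (Q S : List T3) (u₁ u₂ u₃ w₁ w₂ w₃ : T3) : Prop :=
  ∀ W ∈ S, ∃ V ∈ Q, tpull u₁ u₂ u₃ w₁ w₂ w₃ W = tscale (tdet w₁ w₂ w₃) V

/-- A unit tetrahedral frame `(x; b, c)` of first-shell points. [this file] -/
def TetraAt (x b c : T3) : Prop :=
  tsq b = 18 ∧ tsq (tsub b x) = 18 ∧ tsq c = 18 ∧ tsq (tsub c x) = 18 ∧ tsq (tsub b c) = 18

/-- A unit tetrahedral triple of the child model. [this file] -/
def UnitTriple (w₁ w₂ w₃ : T3) : Prop :=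
  tsq w₁ = 18 ∧ tsq w₂ = 18 ∧ tsq (tsub w₁ w₂) = 18 ∧ tsq w₃ = 18 ∧ tsq (tsub w₁ w₃) = 18 ∧ tsq (tsub w₂ w₃) = 18

/-- `mem_of_any_teq` (private; docstring added by the landing lane). [formal bookkeeping] -/
private theorem mem_of_any_teq {P : List T3} {b : T3} (h : P.any (teq b) = true) : b ∈ P := by
  obtain ⟨p, hp, hpb⟩ := List.any_eq_true.1 h
  rw [teq_eq_true] at hpb
  exact hpb ▸ hp

/-- `tetraOkB_sound` (private; docstring added by the landing lane). [formal bookkeeping] -/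
private theorem tetraOkB_sound {P : List T3} {x b c : T3} (h : tetraOkB P x b c = true) :
    b ∈ P ∧ c ∈ P ∧ TetraAt x b c := by
  simp only [tetraOkB, Bool.and_eq_true, beq_iff_eq] at h
  obtain ⟨⟨hb, hc⟩, ⟨⟨⟨hb₁, hbx⟩, hc₁⟩, hcx⟩, hbc⟩ := h
  exact ⟨mem_of_any_teq hb, mem_of_any_teq hc, hb₁, hbx, hc₁, hcx, hbc⟩

/-- `regB_true_iff` (private; docstring added by the landing lane). [formal bookkeeping] -/
private theorem regB_true_iff (P S : List T3) (x b c w₁ w₂ w₃ xr : T3) :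
    regB P (S.map (tpull (tneg x) (tsub b x) (tsub c x) w₁ w₂ w₃)) (tdet w₁ w₂ w₃) xr = true ↔
      RegAt P S xr (tneg x) (tsub b x) (tsub c x) w₁ w₂ w₃ := by
  simp only [regB, RegAt, List.all_eq_true, impB_eq_true, beq_iff_eq, List.any_eq_true, List.mem_map, teq_eq_true]
  constructor
  · intro h V hV hq
    obtain ⟨p, ⟨W, hW, rfl⟩, hp⟩ := h V hV hq
    exact ⟨W, hW, hp⟩
  · intro h V hV hq
    obtain ⟨W, hW, hp⟩ := h V hV hq
    exact ⟨_, ⟨W, hW, rfl⟩, hp⟩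

/-- `conclB_true_iff` (private; docstring added by the landing lane). [formal bookkeeping] -/
private theorem conclB_true_iff (Q S : List T3) (x b c w₁ w₂ w₃ : T3) :
    conclB Q (S.map (tpull (tneg x) (tsub b x) (tsub c x) w₁ w₂ w₃)) (tdet w₁ w₂ w₃) = true ↔
      PullsInto Q S (tneg x) (tsub b x) (tsub c x) w₁ w₂ w₃ := by
  simp only [conclB, PullsInto, List.all_eq_true, List.mem_map, List.any_eq_true, teq_eq_true]
  constructor
  · intro h W hW
    obtain ⟨q, ⟨V, hV, rfl⟩, hq⟩ := h _ ⟨W, hW, rfl⟩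
    exact ⟨V, hV, hq⟩
  · rintro h p ⟨W, hW, rfl⟩
    obtain ⟨V, hV, hq⟩ := h W hW
    exact ⟨_, ⟨V, hV, rfl⟩, hq⟩

/-- **Soundness of the adjacency kernel**: the chosen frame `(x; b, c) = tetraPick P x` is a unit tetrahedral frame of
points of `P`, and every unit triple of `S` registering the adjacent points of every listed parent pulls `S` back into
one of the copies `Qs`. [this file] -/
theorem kernelB_sound {P S : List T3} {x : T3} {xrs : List T3} {Qs : List (List T3)}
    (h : kernelB P x xrs S Qs = true) :
    (tetraPick P x).1 ∈ P ∧ (tetraPick P x).2 ∈ P ∧ TetraAt x (tetraPick P x).1 (tetraPick P x).2 ∧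
    ∀ {w₁ w₂ w₃ : T3}, w₁ ∈ S → w₂ ∈ S → w₃ ∈ S → UnitTriple w₁ w₂ w₃ →
      (∀ xr ∈ xrs, RegAt P S xr (tneg x) (tsub (tetraPick P x).1 x) (tsub (tetraPick P x).2 x) w₁ w₂ w₃) →
      ∃ Q ∈ Qs, PullsInto Q S (tneg x) (tsub (tetraPick P x).1 x) (tsub (tetraPick P x).2 x) w₁ w₂ w₃ := by
  simp only [kernelB, Bool.and_eq_true] at h
  obtain ⟨hok, h⟩ := h
  obtain ⟨hb, hc, ht⟩ := tetraOkB_sound hok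
  refine ⟨hb, hc, ht, ?_⟩
  intro w₁ w₂ w₃ hw₁ hw₂ hw₃ hu hreg
  obtain ⟨h₁, h₂, h₁₂, h₃, h₁₃, h₂₃⟩ := hu
  simp only [List.all_eq_true, impB_eq_true, Bool.and_eq_true, beq_iff_eq] at h
  have key := h w₁ hw₁ h₁ w₂ hw₂ ⟨h₂, h₁₂⟩ w₃ hw₃ ⟨⟨h₃, h₁₃⟩, h₂₃⟩
    (fun xr hxr => (regB_true_iff P S x _ _ w₁ w₂ w₃ xr).2 (hreg xr hxr))
  obtain ⟨Q, hQ, hQ'⟩ := List.any_eq_true.1 key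
  exact ⟨Q, hQ, (conclB_true_iff Q S x _ _ w₁ w₂ w₃).1 hQ'⟩

/-- Soundness, single-parent list form. [this file] -/
theorem kernelOneB_sound {P xs S : List T3} {Qs : List (List T3)} (h : kernelOneB P xs S Qs = true)
    {x : T3} (hx : x ∈ xs) :
    (tetraPick P x).1 ∈ P ∧ (tetraPick P x).2 ∈ P ∧ TetraAt x (tetraPick P x).1 (tetraPick P x).2 ∧
    ∀ {w₁ w₂ w₃ : T3}, w₁ ∈ S → w₂ ∈ S → w₃ ∈ S → UnitTriple w₁ w₂ w₃ →
      RegAt P S x (tneg x) (tsub (tetraPick P x).1 x) (tsub (tetraPick P x).2 x) w₁ w₂ w₃ →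
      ∃ Q ∈ Qs, PullsInto Q S (tneg x) (tsub (tetraPick P x).1 x) (tsub (tetraPick P x).2 x) w₁ w₂ w₃ := by
  have hk : kernelB P x [x] S Qs = true := (List.all_eq_true.1 h) x hx
  obtain ⟨hb, hc, ht, hmain⟩ := kernelB_sound hk
  exact ⟨hb, hc, ht, fun hw₁ hw₂ hw₃ hu hreg => hmain hw₁ hw₂ hw₃ hu (fun xr hxr => by
    rw [List.mem_singleton] at hxr; subst hxr; exact hreg)⟩

/-- Soundness, two-parent cap form: child `x` and the other cap point `x₂ ≠ x` of the same cap of `P`; parents at `0`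
and at `x − x₂`. [this file] -/
theorem kernelTwoB_sound {P S : List T3} {s : ℤ} {Qs : List (List T3)} (h : kernelTwoB P s S Qs = true)
    {x x₂ : T3} (hx : x ∈ capL P s) (hx₂ : x₂ ∈ capL P s) (hne : x ≠ x₂) :
    (tetraPick P x).1 ∈ P ∧ (tetraPick P x).2 ∈ P ∧ TetraAt x (tetraPick P x).1 (tetraPick P x).2 ∧
    ∀ {w₁ w₂ w₃ : T3}, w₁ ∈ S → w₂ ∈ S → w₃ ∈ S → UnitTriple w₁ w₂ w₃ →
      RegAt P S x (tneg x) (tsub (tetraPick P x).1 x) (tsub (tetraPick P x).2 x) w₁ w₂ w₃ →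
      RegAt P S x₂ (tneg x) (tsub (tetraPick P x).1 x) (tsub (tetraPick P x).2 x) w₁ w₂ w₃ →
      ∃ Q ∈ Qs, PullsInto Q S (tneg x) (tsub (tetraPick P x).1 x) (tsub (tetraPick P x).2 x) w₁ w₂ w₃ := by
  have h1 := (List.all_eq_true.1 h) x hx
  have h2 := (List.all_eq_true.1 h1) x₂ hx₂
  rw [impB_eq_true] at h2
  have hne' : teq x x₂ = false := by
    rw [Bool.eq_false_iff]
    exact fun h' => hne ((teq_eq_true x x₂).1 h')
  have hk : kernelB P x [x, x₂] S Qs = true := h2 (by simp [hne'])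
  obtain ⟨hb, hc, ht, hmain⟩ := kernelB_sound hk
  refine ⟨hb, hc, ht, fun hw₁ hw₂ hw₃ hu hreg₁ hreg₂ => hmain hw₁ hw₂ hw₃ hu (fun xr hxr => ?_)⟩
  simp only [List.mem_cons, List.mem_nil_iff, or_false] at hxr
  rcases hxr with rfl | rfl
  · exact hreg₁
  · exact hreg₂

/-- Membership in a cap, unfolded. [this file] -/
theorem mem_capL {P : List T3} {s : ℤ} {v : T3} : v ∈ capL P s ↔ v ∈ P ∧ tsq v = 18 ∧ thsum v = 6 * s := by
  simp [capL, List.mem_filter, Bool.and_eq_true, beq_iff_eq]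

/-! ## §4  Bridges to `Fin 3 → ℤ` and the tree's integer models -/

/-- The conversion to `Fin 3 → ℤ`. [this file] -/
def toV (a : T3) : Fin 3 → ℤ := ![a.1, a.2.1, a.2.2]

/-- `toV_apply_zero` (docstring added by the landing lane; see the module docstring). [formal bookkeeping] -/
@[simp] theorem toV_apply_zero (a : T3) : toV a 0 = a.1 := rfl
/-- `toV_apply_one` (docstring added by the landing lane; see the module docstring). [formal bookkeeping] -/
@[simp] theorem toV_apply_one (a : T3) : toV a 1 = a.2.1 := rfl
/-- `toV_apply_two` (docstring added by the landing lane; see the module docstring). [formal bookkeeping] -/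
@[simp] theorem toV_apply_two (a : T3) : toV a 2 = a.2.2 := rfl

/-- `toV_injective` (docstring added by the landing lane; see the module docstring). [formal bookkeeping] -/
theorem toV_injective : Function.Injective toV := by
  rintro ⟨a₁, a₂, a₃⟩ ⟨b₁, b₂, b₃⟩ h
  have h0 := congrFun h 0; have h1 := congrFun h 1; have h2 := congrFun h 2
  simp only [toV_apply_zero, toV_apply_one, toV_apply_two] at h0 h1 h2
  subst h0; subst h1; subst h2; rfl

/-- `toV_tsub` (docstring added by the landing lane; see the module docstring). [formal bookkeeping] -/
theorem toV_tsub (a b : T3) : toV (tsub a b) = toV a - toV b := by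
  ext i; fin_cases i <;> rfl

/-- `toV_tadd` (docstring added by the landing lane; see the module docstring). [formal bookkeeping] -/
theorem toV_tadd (a b : T3) : toV (tadd a b) = toV a + toV b := by
  ext i; fin_cases i <;> rfl

/-- `toV_tneg` (docstring added by the landing lane; see the module docstring). [formal bookkeeping] -/
theorem toV_tneg (a : T3) : toV (tneg a) = -toV a := by
  ext i; fin_cases i <;> rfl

/-- `toV_tscale` (docstring added by the landing lane; see the module docstring). [formal bookkeeping] -/
theorem toV_tscale (k : ℤ) (a : T3) : toV (tscale k a) = k • toV a := by
  ext i; fin_cases i <;> rfl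

/-- `tsq_eq` (docstring added by the landing lane; see the module docstring). [formal bookkeeping] -/
theorem tsq_eq (a : T3) : tsq a = sqNormInt (toV a) := by
  simp [tsq, sqNormInt, sq]

/-- `tdet_eq` (docstring added by the landing lane; see the module docstring). [formal bookkeeping] -/
theorem tdet_eq (a b c : T3) : tdet a b c = det3Int (toV a) (toV b) (toV c) := by
  simp [tdet, det3Int]

/-- The pull-back is the Cramer combination: `toV (tpull u w W) = Σᵢ (cramerInt w₁ w₂ w₃ W)ᵢ • toV uᵢ`. [this file] -/
theorem toV_tpull (u₁ u₂ u₃ w₁ w₂ w₃ W : T3) :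
    toV (tpull u₁ u₂ u₃ w₁ w₂ w₃ W) =
      cramerInt (toV w₁) (toV w₂) (toV w₃) (toV W) 0 • toV u₁ + cramerInt (toV w₁) (toV w₂) (toV w₃) (toV W) 1 • toV u₂
        + cramerInt (toV w₁) (toV w₂) (toV w₃) (toV W) 2 • toV u₃ := by
  simp only [tpull, toV_tadd, toV_tscale, tdet_eq, cramerInt, Matrix.cons_val_zero, Matrix.cons_val_one,
    Matrix.cons_val]

/-- `fccL` enumerates `fccModelInt`. [this file, by `decide`] -/
theorem fccL_toFinset : (fccL.map toV).toFinset = fccModelInt := by decide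

/-- `hcpL` enumerates `hcpModelInt`. [this file, by `decide`] -/
theorem hcpL_toFinset : (hcpL.map toV).toFinset = hcpModelInt := by decide

/-- `mem_fccModelInt_iff` (docstring added by the landing lane; see the module docstring). [formal bookkeeping] -/
theorem mem_fccModelInt_iff (W : Fin 3 → ℤ) : W ∈ fccModelInt ↔ ∃ p ∈ fccL, toV p = W := by
  rw [← fccL_toFinset, List.mem_toFinset, List.mem_map]

/-- `mem_hcpModelInt_iff` (docstring added by the landing lane; see the module docstring). [formal bookkeeping] -/
theorem mem_hcpModelInt_iff (W : Fin 3 → ℤ) : W ∈ hcpModelInt ↔ ∃ p ∈ hcpL, toV p = W := by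
  rw [← hcpL_toFinset, List.mem_toFinset, List.mem_map]

end Summit.AtomisticToContinuum.Crystallization.Theorems.OverbindingBudgetAffineCompressedCutKernel
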